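import Literature.Probability.LatticeModels.RandomClusterEdgeWeightsRelabel
import Literature.Probability.Percolation.KozmaNitzanPinning
import Summits.CriticalPhenomena.PercolationContinuityZ3.Theorems.PercNearOneGluingNoHeavyLowerTailFKKNConj4
import Summits.CriticalPhenomena.PercolationContinuityZ3.Theorems.PercNearOneGluingNoHeavyLowerTailFKNoHeavyLowerTail
import HarnessLib

/-!
# FK sub-lane: the Kozma–Nitzan family for `φ_{w,q}`, `q ≥ 1`, over EVERY finite vertex type (relabelling along `Fintype.equivFin`)

Support file (`--supports stmt-CriticalPhenomena-4575`), FK sub-lane `prim-bschramm-fk-2` (gen 5) of the post-continuity programme;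
builds on p205010 (kernel theorem, internal audit signed; external expert review pending).  No definitions, no named facts, no sorries;
standard axioms.

The FK dictionary (`…FKAnalogues.lean`) and the theorems of the FK sub-lane are typed over the vertex types `Fin n`, as the route decls are.  A
consumer working in a box of `ℤ^d` (a `Fintype` subtype) needs them over an arbitrary finite vertex type; at `q = 1` the tree does this by the
restriction coupling (`KozmaNitzan2024_conjecture3.fintype`, `Q7Psi.kn_question7_fintype`).  For the random-cluster measure the transport is the
relabel invariance of `φ_{𝐩,q}` (`rcMeasureW_real_preimage_relabel`, `setIntegral_rcMeasureW_relabel`, `RandomClusterEdgeWeightsRelabel.lean`) along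
`e = Fintype.equivFin V`, with the event dictionary of `KozmaNitzanPinning.lean` (`restrictConfig_symm_preimage_openConn`, `…_biUnion_openConn`):

* `FK.rcMeasureW_real_openConn_equivFin`, `FK.rcMeasureW_real_biUnion_openConn_equivFin`, `FK.setIntegral_clusterFun_equivFin` — the dictionary;
* **`FK.additiveGluingFK_fintype`** (`AdditiveGluingFK q`, `0 < q` ⇒ additive gluing under `φ_{w,q}` on every finite vertex type), hence
  `FK.additiveGluing_rc_fintype` (`1 ≤ q`);
* **`FK.nearOneGluingFK_fintype`** / `FK.nearOneGluing_rc_fintype` — Kozma–Nitzan's Conjecture 3 for `φ_{w,q}` on every finite vertex type;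
* **`FK.kn_conj4_rc_fintype`** — Conjecture 4 for `φ_{w,q}`, `q ≥ 1`, on every finite vertex type;
* `FK.lowerTail_real_le_fintype`, **`FK.noHeavyLowerTail_rc_fintype`** — the route crux for `φ_{w,q}`, `q ≥ 1`, on every finite vertex type.
[cite: KozmaNitzan2024, Conj. 1 (p. 3), Conj. 3 (p. 15), Conj. 4 (p. 32)] [cite: Grimmett2006, §1.4 eq. (1.20) (p. 15); §4.3]
-/

noncomputable section

namespace Summit.CriticalPhenomena.PercolationContinuityZ3.Theorems

open MeasureTheory Set Literature.Probability.LatticeModels Literature.Probability.Percolation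
open scoped Classical

namespace FK

universe u

variable {V : Type u} [Fintype V]

/-- The parameters transported to `Fin (card V)` pull back to the original parameters. [folklore] -/
private theorem comp_sym2Equiv_equivFin (w : Sym2 V → unitInterval) :
    (w ∘ sym2Equiv (Fintype.equivFin V).symm) ∘ sym2Equiv (Fintype.equivFin V) = w := by
  funext z
  simp only [Function.comp_apply]
  rw [← sym2Equiv_symm, Equiv.symm_apply_apply]

omit [Fintype V] in
/-- Preimages under relabelling are preimages under the restriction coupling along the inverse. [folklore] -/
private theorem relabel_preimage_eq {W : Type*} (e : V ≃ W) (A : Set (BondConfig W)) :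
    BondConfig.relabel (sym2Equiv e) ⁻¹' A = restrictConfig e.symm ⁻¹' A := by
  ext ω
  rw [mem_preimage, mem_preimage, relabel_sym2Equiv_eq_restrictConfig_symm]

/-- **Dictionary, two-point connections**: with `e = Fintype.equivFin V` and `w' = w ∘ sym2Equiv e⁻¹`,
`φ_{w',q}(e o ↔ e b) = φ_{w,q}(o ↔ b)` (`0 < q`). [cite: Grimmett2006, §4.3] -/
theorem rcMeasureW_real_openConn_equivFin (w : Sym2 V → unitInterval) {q : ℝ} (hq : 0 < q) (o b : V) :
    (rcMeasureW (w ∘ sym2Equiv (Fintype.equivFin V).symm) q ∅).real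
        (openConn (Fintype.equivFin V o) (Fintype.equivFin V b)) = (rcMeasureW w q ∅).real (openConn o b) := by
  set e := Fintype.equivFin V with he
  have h := rcMeasureW_real_preimage_relabel e (w ∘ sym2Equiv e.symm) hq (∅ : Set V) (openConn (e o) (e b))
  rw [comp_sym2Equiv_equivFin, image_empty, relabel_preimage_eq, restrictConfig_symm_preimage_openConn] at h
  exact h.symm

/-- **Dictionary, the union event**: `φ_{w',q}(e o ↔ e(A)) = φ_{w,q}(o ↔ A)` (`0 < q`). [cite: Grimmett2006, §4.3] -/
theorem rcMeasureW_real_biUnion_openConn_equivFin (w : Sym2 V → unitInterval) {q : ℝ} (hq : 0 < q) (o : V) (A : Finset V) :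
    (rcMeasureW (w ∘ sym2Equiv (Fintype.equivFin V).symm) q ∅).real
        (⋃ a ∈ A.map (Fintype.equivFin V).toEmbedding, openConn (Fintype.equivFin V o) a) =
      (rcMeasureW w q ∅).real (⋃ a ∈ A, openConn o a) := by
  set e := Fintype.equivFin V with he
  have h := rcMeasureW_real_preimage_relabel e (w ∘ sym2Equiv e.symm) hq (∅ : Set V)
    (⋃ a ∈ A.map e.toEmbedding, (openConn (e o) a : Set (BondConfig (Fin (Fintype.card V)))))
  rw [comp_sym2Equiv_equivFin, image_empty, relabel_preimage_eq, restrictConfig_symm_preimage_biUnion_openConn] at h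
  exact h.symm

omit [Fintype V] in
/-- The relabelled open cluster is the image of the open cluster. [folklore] -/
private theorem openCluster_relabel {W : Type*} (e : V ≃ W) (ω : BondConfig V) (a : V) :
    openCluster (BondConfig.relabel (sym2Equiv e) ω) (e a) = e '' openCluster ω a := by
  ext x
  rw [Equiv.image_eq_preimage_symm]
  have h := restrictConfig_symm_preimage_openConn e a (e.symm x)
  rw [Equiv.apply_symm_apply] at h
  have hx : ω ∈ restrictConfig e.symm ⁻¹' (openConn (e a) x : Set (BondConfig W)) ↔ ω ∈ (openConn a (e.symm x) : Set (BondConfig V)) := by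
    rw [h]
  rw [mem_preimage, ← relabel_sym2Equiv_eq_restrictConfig_symm] at hx
  exact hx

/-- **Dictionary, restricted expectations of cluster properties**: with `F'(S) = F(e⁻¹(S))`,
`∫_{e o ↔ e(A)} F'(C(e x)) dφ_{w',q} = ∫_{o ↔ A} F(C(x)) dφ_{w,q}` (`0 < q`). [cite: Grimmett2006, §4.3] -/
theorem setIntegral_clusterFun_equivFin (w : Sym2 V → unitInterval) {q : ℝ} (hq : 0 < q) (o x : V) (A : Finset V)
    (F : Set V → ℝ) :
    ∫ ω' in ⋃ a ∈ A.map (Fintype.equivFin V).toEmbedding, openConn (Fintype.equivFin V o) a,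
        F (Fintype.equivFin V ⁻¹' openCluster ω' (Fintype.equivFin V x))
          ∂(rcMeasureW (w ∘ sym2Equiv (Fintype.equivFin V).symm) q ∅) =
      ∫ ω in ⋃ a ∈ A, openConn o a, F (openCluster ω x) ∂(rcMeasureW w q ∅) := by
  set e := Fintype.equivFin V with he
  have h := setIntegral_rcMeasureW_relabel e (w ∘ sym2Equiv e.symm) hq (∅ : Set V)
    (fun ω' => F (e ⁻¹' openCluster ω' (e x)))
    (⋃ a ∈ A.map e.toEmbedding, (openConn (e o) a : Set (BondConfig (Fin (Fintype.card V)))))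
  rw [comp_sym2Equiv_equivFin, image_empty, relabel_preimage_eq, restrictConfig_symm_preimage_biUnion_openConn] at h
  rw [h]
  refine setIntegral_congr_fun MeasurableSet.of_discrete fun ω _ => ?_
  show F (e ⁻¹' openCluster (BondConfig.relabel (sym2Equiv e) ω) (e x)) = F (openCluster ω x)
  rw [openCluster_relabel, Equiv.preimage_image]

/-- Full expectations: `∫ F'(C(e x)) dφ_{w',q} = ∫ F(C(x)) dφ_{w,q}`. [cite: Grimmett2006, §4.3] -/
theorem integral_clusterFun_equivFin (w : Sym2 V → unitInterval) {q : ℝ} (hq : 0 < q) (x : V) (F : Set V → ℝ) :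
    ∫ ω', F (Fintype.equivFin V ⁻¹' openCluster ω' (Fintype.equivFin V x)) ∂(rcMeasureW (w ∘ sym2Equiv (Fintype.equivFin V).symm) q ∅) =
      ∫ ω, F (openCluster ω x) ∂(rcMeasureW w q ∅) := by
  set e := Fintype.equivFin V with he
  have h := integral_rcMeasureW_relabel e (w ∘ sym2Equiv e.symm) hq (∅ : Set V) (fun ω' => F (e ⁻¹' openCluster ω' (e x)))
  rw [comp_sym2Equiv_equivFin, image_empty] at h
  rw [h]
  refine integral_congr_ae (Filter.Eventually.of_forall fun ω => ?_)
  show F (e ⁻¹' openCluster (BondConfig.relabel (sym2Equiv e) ω) (e x)) = F (openCluster ω x)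
  rw [openCluster_relabel, Equiv.preimage_image]

/-! ### The transports -/

/-- **FK additive gluing over every finite vertex type** (`0 < q`): `AdditiveGluingFK q` (typed over `Fin n`) gives additive gluing under
`φ_{w,q}` for every finite vertex type `V`, every `w : Sym2 V → [0,1]`, every `A, o, b`. [cite: KozmaNitzan2024, Conj. 1 (p. 3)] [cite: Grimmett2006, §4.3] -/
theorem additiveGluingFK_fintype {q : ℝ} (hq : 0 < q) (hAG : AdditiveGluingFK q) (V : Type u) [Fintype V]
    (w : Sym2 V → unitInterval) (A : Finset V) (o b : V) : AdditiveGluingUnder (rcMeasureW w q ∅) A o b := by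
  intro t ht hAb
  set e := Fintype.equivFin V with he
  have h := hAG (Fintype.card V) (w ∘ sym2Equiv e.symm) (A.map e.toEmbedding) (e o) (e b) t ht (fun a ha => by
    rw [Finset.mem_map_equiv] at ha
    have := hAb (e.symm a) ha
    rwa [← rcMeasureW_real_openConn_equivFin w hq, Equiv.apply_symm_apply] at this)
  rwa [rcMeasureW_real_biUnion_openConn_equivFin w hq, rcMeasureW_real_openConn_equivFin w hq] at h

/-- **Additive gluing for `φ_{w,q}`, `q ≥ 1`, on EVERY finite vertex type** (every `w ∈ [0,1]^{Sym2 V}`).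
[cite: KozmaNitzan2024, Conj. 1 (p. 3)] [cite: Grimmett2006, §1.4 eq. (1.20) (p. 15); §4.3] -/
theorem additiveGluing_rc_fintype {q : ℝ} (hq : 1 ≤ q) (V : Type u) [Fintype V] (w : Sym2 V → unitInterval) (A : Finset V) (o b : V) :
    AdditiveGluingUnder (rcMeasureW w q ∅) A o b :=
  additiveGluingFK_fintype (one_pos.trans_le hq) (additiveGluingFK_of_one_le hq) V w A o b

/-- **FK near-one gluing (Kozma–Nitzan's Conjecture 3 shape) over every finite vertex type** (`0 < q`), with the SAME `δ(ε)`.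
[cite: KozmaNitzan2024, Conj. 3 (p. 15)] [cite: Grimmett2006, §4.3] -/
theorem nearOneGluingFK_fintype {q : ℝ} (hq : 0 < q) (hX : NearOneGluingFK q) {ε : ℝ} (hε : 0 < ε) :
    ∃ δ : ℝ, 0 < δ ∧ ∀ (V : Type u) [Fintype V] (w : Sym2 V → unitInterval) (A : Finset V) (o b : V),
      1 - δ < (rcMeasureW w q ∅).real (⋃ a ∈ A, openConn o a) →
        (∀ a ∈ A, 1 - δ < (rcMeasureW w q ∅).real (openConn a b)) →
          1 - ε < (rcMeasureW w q ∅).real (openConn o b) := by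
  obtain ⟨δ, hδ, h⟩ := hX ε hε
  refine ⟨δ, hδ, fun V _ w A o b hoA hab => ?_⟩
  set e := Fintype.equivFin V with he
  have h1 := h (Fintype.card V) (w ∘ sym2Equiv e.symm) (A.map e.toEmbedding) (e o) (e b)
    (by rwa [rcMeasureW_real_biUnion_openConn_equivFin w hq]) (by
      intro a ha
      rw [Finset.mem_map_equiv] at ha
      have := hab (e.symm a) ha
      rwa [← rcMeasureW_real_openConn_equivFin w hq, Equiv.apply_symm_apply] at this)
  rwa [rcMeasureW_real_openConn_equivFin w hq] at h1

/-- **Kozma–Nitzan's Conjecture 3 for `φ_{w,q}`, `q ≥ 1`, on EVERY finite vertex type.** [cite: KozmaNitzan2024, Conj. 3 (p. 15)] -/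
theorem nearOneGluing_rc_fintype {q : ℝ} (hq : 1 ≤ q) {ε : ℝ} (hε : 0 < ε) :
    ∃ δ : ℝ, 0 < δ ∧ ∀ (V : Type u) [Fintype V] (w : Sym2 V → unitInterval) (A : Finset V) (o b : V),
      1 - δ < (rcMeasureW w q ∅).real (⋃ a ∈ A, openConn o a) →
        (∀ a ∈ A, 1 - δ < (rcMeasureW w q ∅).real (openConn a b)) →
          1 - ε < (rcMeasureW w q ∅).real (openConn o b) :=
  nearOneGluingFK_fintype (one_pos.trans_le hq) (nearOneGluingFK_of_one_le hq) hε

/-- **Kozma–Nitzan's Conjecture 4 for `φ_{w,q}`, `q ≥ 1`, on EVERY finite vertex type** (every `w ∈ [0,1]^{Sym2 V}`, every `A ≠ ∅`, every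
`0`, every monotone `F`): some `a ∈ A` has `E_φ[F(C(a)); 0 ↔ A] ≤ E_φ[F(C(0)); 0 ↔ A]`. [cite: KozmaNitzan2024, Conj. 4 (p. 32)] [cite: Grimmett2006, §4.3] -/
theorem kn_conj4_rc_fintype {q : ℝ} (hq : 1 ≤ q) (V : Type u) [Fintype V] (w : Sym2 V → unitInterval)
    (A : Finset V) (o : V) (F : Set V → ℝ) (hF : ∀ S T : Set V, S ⊆ T → F S ≤ F T) (hA : A.Nonempty) :
    ∃ a ∈ A, ∫ ω in ⋃ a' ∈ A, openConn o a', F (openCluster ω a) ∂(rcMeasureW w q ∅) ≤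
      ∫ ω in ⋃ a' ∈ A, openConn o a', F (openCluster ω o) ∂(rcMeasureW w q ∅) := by
  have hq0 : 0 < q := one_pos.trans_le hq
  set e := Fintype.equivFin V with he
  set F' : Set (Fin (Fintype.card V)) → ℝ := fun S => F (e ⁻¹' S) with hF'
  have hF'mono : ∀ S T : Set (Fin (Fintype.card V)), S ⊆ T → F' S ≤ F' T :=
    fun S T hST => hF _ _ (preimage_mono hST)
  obtain ⟨a', ha', hle⟩ := kn_conj4_rc hq (w ∘ sym2Equiv e.symm) (A.map e.toEmbedding) (e o) F' hF'mono
    (by simpa using hA)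
  rw [Finset.mem_map_equiv] at ha'
  refine ⟨e.symm a', ha', ?_⟩
  have h1 := setIntegral_clusterFun_equivFin w hq0 o (e.symm a') A F
  have h2 := setIntegral_clusterFun_equivFin w hq0 o o A F
  rw [Equiv.apply_symm_apply] at h1
  rw [← h1, ← h2]
  exact hle

/-- **The lower tail of the number of met relays, under ANY probability measure, any finite vertex type** (`FK.lowerTail_real_le` with `V`
for `Fin n`): relays each met w.p. `> 1 − η` (`η ≥ 0`), `δ ≤ ε/2` ⇒ `μ(1 ≤ N < δ·(Σ_a μ(o ↔ a))/ε) ≤ 2η`. [folklore] -/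
theorem lowerTail_real_le_fintype (μ : Measure (BondConfig V)) [IsProbabilityMeasure μ] (A : Finset V) (o : V)
    {ε δ η : ℝ} (hε : 0 < ε) (hδ : δ ≤ ε / 2) (hη : 0 ≤ η) (hrel : ∀ a ∈ A, 1 - η < μ.real (openConn o a)) :
    μ.real {ω : BondConfig V | 1 ≤ (A.filter fun a => ω ∈ openConn o a).card ∧
        ((A.filter fun a => ω ∈ openConn o a).card : ℝ) < δ * (∑ a ∈ A, μ.real (openConn o a)) / ε} ≤ 2 * η := by
  classical
  have hmeas : ∀ S : Set (BondConfig V), MeasurableSet S := fun _ => MeasurableSet.of_discrete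
  have hint : ∀ (g : BondConfig V → ℝ), Integrable g μ := fun g => Integrable.of_finite
  set N : BondConfig V → ℝ := fun ω => ((A.filter fun a => ω ∈ openConn o a).card : ℝ) with hN
  set EN : ℝ := ∑ a ∈ A, μ.real (openConn o a) with hEN
  set m : ℝ := (A.card : ℝ) with hm
  set E : Set (BondConfig V) := {ω : BondConfig V | 1 ≤ (A.filter fun a => ω ∈ openConn o a).card ∧
      ((A.filter fun a => ω ∈ openConn o a).card : ℝ) < δ * EN / ε} with hE
  -- trivial case `A = ∅`: the event is empty
  rcases A.eq_empty_or_nonempty with hA0 | hAne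
  · have hEempty : E = ∅ := by
      ext ω
      simp only [hE, hA0, Finset.filter_empty, Finset.card_empty, mem_setOf_eq, mem_empty_iff_false, iff_false, not_and]
      intro h; exact absurd h (by norm_num)
    show μ.real E ≤ 2 * η
    rw [hEempty, measureReal_empty]
    linarith
  -- `A ≠ ∅`
  have hmpos : 0 < m := by rw [hm]; exact_mod_cast Finset.card_pos.2 hAne
  have hENle : EN ≤ m := by
    rw [hEN, hm]
    calc ∑ a ∈ A, μ.real (openConn o a) ≤ ∑ _a ∈ A, (1 : ℝ) := Finset.sum_le_sum fun a _ => measureReal_le_one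
      _ = (A.card : ℝ) := by simp
  have hENgt : m * (1 - η) < EN := by
    rw [hEN, hm]
    calc (A.card : ℝ) * (1 - η) = ∑ _a ∈ A, (1 - η) := by rw [Finset.sum_const, nsmul_eq_mul]
      _ < ∑ a ∈ A, μ.real (openConn o a) := Finset.sum_lt_sum_of_nonempty hAne fun a ha => hrel a ha
  -- `E[N] = EN`
  have hNsum : ∀ ω, N ω = ∑ a ∈ A, (openConn o a : Set (BondConfig V)).indicator (1 : BondConfig V → ℝ) ω := by
    intro ω
    rw [hN]
    simp only [indicator_apply, Pi.one_apply, Finset.sum_boole]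
  have hintN : ∫ ω, N ω ∂μ = EN := by
    simp_rw [hNsum]
    rw [integral_finsetSum _ fun a _ => hint _]
    exact Finset.sum_congr rfl fun a _ => integral_indicator_one (hmeas _)
  -- on `E`: `m/2 ≤ m − N`
  have hptE : ∀ ω ∈ E, m / 2 ≤ m - N ω := by
    intro ω hω
    have h2 : N ω < δ * EN / ε := hω.2
    have hEN0 : 0 ≤ EN := Finset.sum_nonneg fun a _ => measureReal_nonneg
    have h3 : δ * EN / ε ≤ EN / 2 := by
      rw [div_le_iff₀ hε]
      nlinarith [hδ, hEN0]
    linarith [hENle]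
  -- `N ≤ m` everywhere
  have hNle : ∀ ω, N ω ≤ m := by
    intro ω
    show ((A.filter fun a => ω ∈ openConn o a).card : ℝ) ≤ (A.card : ℝ)
    exact_mod_cast Finset.card_filter_le _ _
  -- Markov: `(m/2) μ(E) ≤ ∫ (m − N) = m − EN < m η`
  have h1 : ∫ _ω in E, (m / 2 : ℝ) ∂μ = (m / 2) * μ.real E := by
    rw [setIntegral_const, smul_eq_mul, mul_comm]
  have h2 : ∫ _ω in E, (m / 2 : ℝ) ∂μ ≤ ∫ ω in E, (m - N ω) ∂μ :=
    setIntegral_mono_on (hint _).integrableOn (hint _).integrableOn (hmeas E) fun ω hω => hptE ω hω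
  have h3 : ∫ ω in E, (m - N ω) ∂μ ≤ ∫ ω, (m - N ω) ∂μ :=
    setIntegral_le_integral (hint _) (Filter.Eventually.of_forall fun ω => by
      simp only [Pi.zero_apply]; linarith [hNle ω])
  have h4 : ∫ ω, (m - N ω) ∂μ = m - EN := by
    rw [integral_sub (hint _) (hint _), integral_const, smul_eq_mul, hintN]
    simp
  have h5 : (m / 2) * μ.real E ≤ m - EN := by linarith [h1, h2, h3, h4]
  have h6 : m - EN < m * η := by linarith [hENgt]
  have h7 : m * μ.real E < m * (2 * η) := by nlinarith [h5, h6, hmpos]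
  exact (lt_of_mul_lt_mul_left h7 hmpos.le).le


/-- **The route crux `NoHeavyLowerTail` for `φ_{w,q}`, `q ≥ 1`, on EVERY finite vertex type**: `∀ ε ∃ δ` such that for every finite `V`, every
`w ∈ [0,1]^{Sym2 V}`, every `A, o`: `φ(o ↔ A) > 1 − δ` and pairwise `(1−δ)`-reliability of `A` imply `φ(1 ≤ N < δ·E N/ε) < ε`
(`N = |C(o) ∩ A|`).  From `FK.nearOneGluing_rc_fintype` and the measure-generic lower-tail bound. [cite: KozmaNitzan2024, Conj. 1 (p. 3), Conj. 3 (p. 15)] -/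
theorem noHeavyLowerTail_rc_fintype {q : ℝ} (hq : 1 ≤ q) {ε : ℝ} (hε : 0 < ε) :
    ∃ δ : ℝ, 0 < δ ∧ ∀ (V : Type u) [Fintype V] (w : Sym2 V → unitInterval) (A : Finset V) (o : V),
      1 - δ < (rcMeasureW w q ∅).real (⋃ a ∈ A, openConn o a) →
        (∀ a ∈ A, ∀ a' ∈ A, 1 - δ < (rcMeasureW w q ∅).real (openConn a a')) →
          (rcMeasureW w q ∅).real {ω | 1 ≤ (A.filter fun a => ω ∈ openConn o a).card ∧
            ((A.filter fun a => ω ∈ openConn o a).card : ℝ) <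
              δ * (∑ a ∈ A, (rcMeasureW w q ∅).real (openConn o a)) / ε} < ε := by
  obtain ⟨δ₁, hδ₁, hNOG⟩ := nearOneGluing_rc_fintype.{u} hq (show (0 : ℝ) < ε / 4 by positivity)
  refine ⟨min δ₁ (ε / 2), lt_min hδ₁ (by positivity), ?_⟩
  intro V _ w A o hoA hrel
  haveI := isProbabilityMeasure_rcMeasureW w (one_pos.trans_le hq) (∅ : Set V)
  have hoA' : 1 - δ₁ < (rcMeasureW w q ∅).real (⋃ a ∈ A, openConn o a) := lt_of_le_of_lt (by linarith [min_le_left δ₁ (ε / 2)]) hoA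
  have hmet : ∀ a' ∈ A, 1 - ε / 4 < (rcMeasureW w q ∅).real (openConn o a') := by
    intro a' ha'
    exact hNOG V w A o a' hoA' fun a ha => lt_of_le_of_lt (by linarith [min_le_left δ₁ (ε / 2)]) (hrel a ha a' ha')
  have key := lowerTail_real_le_fintype (rcMeasureW w q ∅) A o hε (min_le_right δ₁ (ε / 2)) (by positivity) hmet
  linarith

end FK

end Summit.CriticalPhenomena.PercolationContinuityZ3.Theorems

end
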